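import Mathlib
import Summits.Ventures.PercRepro2.HCov
import Summits.Ventures.PercRepro2.EdgeCubic
import Summits.Ventures.PercRepro2.EdgeCubicAll
import Summits.Ventures.PercRepro2.CPolarA3
import Summits.Ventures.PercRepro2.CPolarA3Marks
import Summits.Ventures.PercRepro2.PendantClusterPins
import Summits.Ventures.PercRepro2.PendantClusterBern
import Summits.Ventures.PercRepro2.CPolarA3Exists
import Summits.Ventures.PercRepro2.ClusterRootBern
import Summits.Ventures.PercRepro2.EdgeReloc
import Summits.Ventures.PercRepro2.ReachRootEdge

/-!
# Row 2′CPOLAR FROM THE OPEN PIN'S SLACK ALONE — the unified target (SUB) and its reduction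
(blind cell PercRepro2, p5 g16; `proofs/P5-OEDGE.md` §20)

Along a fractional edge `e` write `Q_s`, `D_s` for the masses `P(Q)`, `P(PD)` of the pinned instances
`p[e↦s]` (`s = 0, 1`) and `Gc₀` for the covariance form at `p[e↦0]`. The general one-edge Bernstein
identity (`proofs/P5-OEDGE.md` §15) reads `B1/(Q₀²Q₁) = (α₀+α₁)·G₀ + α₀·G₁ + P1(e)`,
`B2/(Q₀Q₁²) = (α₀+α₁)·G₁ + α₁·G₀ + P2(e)` with `α_s = D_s/Q_s`, `G_s = Gc_s/(D_s Q_s²)` and two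
`t`-free pieces. The census of this seat (and the climbs of kit j275644) finds that the CLOSED pin's
slack `G₀` is never needed: `B1/(Q₀²Q₁) ≥ (α₀+α₁)·G₀` and `B2/(Q₀Q₁²) ≥ α₁·G₀` on every `a₃`-edge
line seen, while the open pin's slack `G₁` is. Cleared of denominators these are

  **`Sub1`**: `(Q₁D₀ + Q₀D₁)·Gc₀ ≤ Q₀D₀·B1`,   **`Sub2`**: `Q₁D₁·Gc₀ ≤ Q₀D₀·B2`,

statements about the landed `B1`, `B2`, `Gc`. At an `a₃–o` edge they are `P1 ≥ 0`, `P2 ≥ 0`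
(`Gc₁ = 0` there); at a pendant edge of `a₃`, `Sub1` is exactly the census inequality (PM⁺) ≥ 0 of
`proofs/P5-OEDGE.md` §16 (the identity `Q·D_u·B1 = Q·D_u·Gc₀ + D_u²·Gc₀ + Q²·Gc₁ + Q·(…)·(…)`
with `D₀ = Q`, `D₁ = D_u`); at a root edge both are the theorem of RootEdgeBern.lean.

* **`bern_nonneg_of_sub`**: with `0 < Q₀`, `0 < D₀` and (HCOV) at `p[e↦0]`, `Sub1 ∧ Sub2` gives
  `0 ≤ B1 ∧ 0 ≤ B2` — the closure principle `HCov_of_update_zero_of_bern` then passes (HCOV) from the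
  two pins to `p` (**`HCov_of_update_zero_of_sub`**);
* `GoodEdgeSub` (`GoodEdge''` ∨ non-degenerate pins with `Sub1 ∧ Sub2`), **`HCov_of_bern_a3_exists_sub`**
  (the induction of ReachRootEdge.lean verbatim with the new case) and
  **`HCov_all_of_cpolarA3Sub_all : CPolarA3Sub_all R → HCov_all R`** — the crux from (SUB) at one
  `a₃`-edge per mark-free instance (reach-root and pendant-PA edges free).
-/

namespace Summit.Ventures.PercRepro2

open UnionCluster CovForm CovForm.CPolarA3 PendantCluster CPolarA3Exists ClusterRoot ReachRoot

namespace CPolarSub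

open EdgeLine

section Sub

variable {V : Type*} {E : Type*} [Fintype E] [DecidableEq E] {R : Type*} [Field R]
  [LinearOrder R]

/-- **`Sub1`**: `(Q₁D₀ + Q₀D₁)·Gc₀ ≤ Q₀D₀·B1` — the cleared form of
`B1/(Q₀²Q₁) ≥ (α₀+α₁)·G₀` (the closed pin's slack is not needed for `B1`). -/
def Sub1 (p : E → R) (ends : E → Sym2 V) (o a₁ a₂ a₃ b : V) (e : E) : Prop :=
  (prob (Function.update p e 1) (avoidAll ends a₂ {a₁}) *
      prob (Function.update p e 0) (PDEvent ends a₁ a₂ a₃) +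
    prob (Function.update p e 0) (avoidAll ends a₂ {a₁}) *
      prob (Function.update p e 1) (PDEvent ends a₁ a₂ a₃)) *
      Gc (Function.update p e 0) ends o a₁ a₂ a₃ b ≤
    prob (Function.update p e 0) (avoidAll ends a₂ {a₁}) *
      prob (Function.update p e 0) (PDEvent ends a₁ a₂ a₃) * B1 p ends o a₁ a₂ a₃ b e

/-- **`Sub2`**: `Q₁D₁·Gc₀ ≤ Q₀D₀·B2` — the cleared form of `B2/(Q₀Q₁²) ≥ α₁·G₀`. -/
def Sub2 (p : E → R) (ends : E → Sym2 V) (o a₁ a₂ a₃ b : V) (e : E) : Prop :=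
  prob (Function.update p e 1) (avoidAll ends a₂ {a₁}) *
      prob (Function.update p e 1) (PDEvent ends a₁ a₂ a₃) *
      Gc (Function.update p e 0) ends o a₁ a₂ a₃ b ≤
    prob (Function.update p e 0) (avoidAll ends a₂ {a₁}) *
      prob (Function.update p e 0) (PDEvent ends a₁ a₂ a₃) * B2 p ends o a₁ a₂ a₃ b e

/-- The pinned masses of `e` are non-degenerate: `0 < Q₀` and `0 < D₀`. -/
def PinsPos (p : E → R) (ends : E → Sym2 V) (a₁ a₂ a₃ : V) (e : E) : Prop :=
  0 < prob (Function.update p e 0) (avoidAll ends a₂ {a₁}) ∧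
    0 < prob (Function.update p e 0) (PDEvent ends a₁ a₂ a₃)

variable [IsStrictOrderedRing R]

/-- **`0 ≤ B1 ∧ 0 ≤ B2` from (SUB)** at non-degenerate pins, given (HCOV) at `p[e↦0]`. -/
theorem bern_nonneg_of_sub (p : E → R) (hp : IsProbVec p) (ends : E → Sym2 V)
    (o a₁ a₂ a₃ b : V) (e : E) (hpos : PinsPos p ends a₁ a₂ a₃ e)
    (h₀ : HCov (Function.update p e 0) ends o a₁ a₂ a₃ b)
    (h1 : Sub1 p ends o a₁ a₂ a₃ b e) (h2 : Sub2 p ends o a₁ a₂ a₃ b e) :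
    0 ≤ B1 p ends o a₁ a₂ a₃ b e ∧ 0 ≤ B2 p ends o a₁ a₂ a₃ b e := by
  unfold Sub1 at h1
  unfold Sub2 at h2
  unfold HCov at h₀
  have hp₁ : IsProbVec (Function.update p e 1) := hp.update e zero_le_one le_rfl
  have hQ₁ := prob_nonneg hp₁ (avoidAll ends a₂ {a₁})
  have hD₁ := prob_nonneg hp₁ (PDEvent ends a₁ a₂ a₃)
  have hQD : 0 < prob (Function.update p e 0) (avoidAll ends a₂ {a₁}) *
      prob (Function.update p e 0) (PDEvent ends a₁ a₂ a₃) := mul_pos hpos.1 hpos.2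
  constructor
  · have hl : 0 ≤ (prob (Function.update p e 1) (avoidAll ends a₂ {a₁}) *
        prob (Function.update p e 0) (PDEvent ends a₁ a₂ a₃) +
        prob (Function.update p e 0) (avoidAll ends a₂ {a₁}) *
          prob (Function.update p e 1) (PDEvent ends a₁ a₂ a₃)) *
          Gc (Function.update p e 0) ends o a₁ a₂ a₃ b :=
      mul_nonneg (add_nonneg (mul_nonneg hQ₁ hpos.2.le) (mul_nonneg hpos.1.le hD₁)) h₀
    exact (mul_nonneg_iff_of_pos_left hQD).1 (hl.trans h1)
  · have hl : 0 ≤ prob (Function.update p e 1) (avoidAll ends a₂ {a₁}) *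
        prob (Function.update p e 1) (PDEvent ends a₁ a₂ a₃) *
          Gc (Function.update p e 0) ends o a₁ a₂ a₃ b :=
      mul_nonneg (mul_nonneg hQ₁ hD₁) h₀
    exact (mul_nonneg_iff_of_pos_left hQD).1 (hl.trans h2)

/-- **(HCOV) from (SUB) at one edge**: (HCOV) at both pins and `Sub1 ∧ Sub2` at non-degenerate pins
give (HCOV) at `p`. -/
theorem HCov_of_update_zero_of_sub (p : E → R) (hp : IsProbVec p) (ends : E → Sym2 V)
    (o a₁ a₂ a₃ b : V) (e : E) (hpos : PinsPos p ends a₁ a₂ a₃ e)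
    (h₀ : HCov (Function.update p e 0) ends o a₁ a₂ a₃ b)
    (h₁ : HCov (Function.update p e 1) ends o a₁ a₂ a₃ b)
    (h1 : Sub1 p ends o a₁ a₂ a₃ b e) (h2 : Sub2 p ends o a₁ a₂ a₃ b e) :
    HCov p ends o a₁ a₂ a₃ b :=
  let h := bern_nonneg_of_sub p hp ends o a₁ a₂ a₃ b e hpos h₀ h1 h2
  HCov_of_update_zero_of_bern p hp ends o a₁ a₂ a₃ b e h₀ h₁ h.1 h.2

end Sub

/-! ## The induction with (SUB) as the per-edge hypothesis -/

section Induction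

variable {V : Type*} {E : Type*} [Fintype V] [DecidableEq V] [Fintype E] [DecidableEq E]
  {R : Type*} [Field R] [LinearOrder R] [IsStrictOrderedRing R]

/-- An edge the induction can take: a good edge of ReachRootEdge.lean, or an edge with
non-degenerate pins satisfying (SUB). -/
def GoodEdgeSub (q : E → R) (ends : E → Sym2 V) (o a₁ a₂ a₃ b : V) (e : E) : Prop :=
  GoodEdge'' q ends o a₁ a₂ a₃ b e ∨
    (PinsPos q ends a₁ a₂ a₃ e ∧ Sub1 q ends o a₁ a₂ a₃ b e ∧ Sub2 q ends o a₁ a₂ a₃ b e)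

/-- **(HCOV) when every mark-free admissible weight vector with a fractional edge touching the reach
of `a₃` has a fractional edge touching the reach that is good or satisfies (SUB).** -/
theorem HCov_of_bern_a3_exists_sub (ends : E → Sym2 V) (o a₁ a₂ a₃ b : V)
    (hB : ∀ q : E → R, IsProbVec q → MarkFree q ends o a₁ a₂ a₃ b →
      (∃ e ∈ fracEdges q, TouchesReach q ends a₃ e) →
      ∃ e ∈ fracEdges q, TouchesReach q ends a₃ e ∧ GoodEdgeSub q ends o a₁ a₂ a₃ b e)
    (p : E → R) (hp : IsProbVec p) : HCov p ends o a₁ a₂ a₃ b := by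
  generalize hn : (fracEdges p).card = n
  induction n using Nat.strong_induction_on generalizing p with
  | _ n ih =>
    by_cases hm : a₁ ∈ pinnedReach p ends a₃ ∨ a₂ ∈ pinnedReach p ends a₃ ∨
        o ∈ pinnedReach p ends a₃ ∨ b ∈ pinnedReach p ends a₃
    · exact HCov_of_mark_mem_pinnedReach hp hm
    · have hfree : MarkFree p ends o a₁ a₂ a₃ b := by
        simp only [not_or] at hm
        exact ⟨hm.1, hm.2.1, hm.2.2.1, hm.2.2.2⟩
      by_cases h : ∃ e ∈ fracEdges p, TouchesReach p ends a₃ e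
      · obtain ⟨e, he, _, hgood⟩ := hB p hp hfree h
        have hlt : ((fracEdges p).erase e).card < n := by
          rw [← hn]; exact Finset.card_erase_lt_of_mem he
        have hp₀ : IsProbVec (Function.update p e 0) := hp.update e le_rfl zero_le_one
        have hp₁ : IsProbVec (Function.update p e 1) := hp.update e zero_le_one le_rfl
        have h₀ : HCov (Function.update p e 0) ends o a₁ a₂ a₃ b :=
          ih _ hlt (Function.update p e 0) hp₀ (by rw [fracEdges_update p e 0 (Or.inl rfl)])
        have h₁ : HCov (Function.update p e 1) ends o a₁ a₂ a₃ b :=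
          ih _ hlt (Function.update p e 1) hp₁ (by rw [fracEdges_update p e 1 (Or.inr rfl)])
        have hfe : p e ≠ 0 ∧ p e ≠ 1 := by simpa [fracEdges] using he
        rcases hgood with (hr | hpa | ⟨hB1, hB2⟩) | ⟨hpos, h1, h2⟩
        · obtain ⟨hB1, hB2⟩ := bern_nonneg_of_isReachRootEdge p hp ends o a₁ a₂ a₃ b e hr hfe.2 h₀
          exact HCov_of_update_zero_of_bern p hp ends o a₁ a₂ a₃ b e h₀ h₁ hB1 hB2
        · obtain ⟨hK, z, u, hends, hz, hu, hD, hcov⟩ := hpa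
          exact HCov_cluster_of_cov_nonneg p hp hK hends hz hu hfe.2 hfree.1 hfree.2.1
            hfree.2.2.1 hfree.2.2.2 hD h₀ h₁ hcov
        · exact HCov_of_update_zero_of_bern p hp ends o a₁ a₂ a₃ b e h₀ h₁ hB1 hB2
        · exact HCov_of_update_zero_of_sub p hp ends o a₁ a₂ a₃ b e hpos h₀ h₁ h1 h2
      · simp only [not_exists, not_and] at h
        exact HCov_of_reach_pinned p hp ends o a₁ a₂ a₃ b h

end Induction

section Closure

variable (R : Type*) [Field R] [LinearOrder R] [IsStrictOrderedRing R]

/-- **(SUB) at one `a₃`-edge per mark-free instance** (reach-root and pendant-PA edges free). -/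
def CPolarA3Sub_all : Prop :=
  ∀ (V E : Type) [Fintype V] [DecidableEq V] [Fintype E] [DecidableEq E]
    (ends : E → Sym2 V) (p : E → R), IsProbVec p →
    ∀ o a₁ a₂ a₃ b : V, a₁ ≠ a₂ → a₁ ≠ a₃ → a₂ ≠ a₃ → o ≠ a₁ → o ≠ a₂ → o ≠ a₃ → o ≠ b →
      b ≠ a₁ → b ≠ a₂ → b ≠ a₃ → MarkFree p ends o a₁ a₂ a₃ b →
      (∃ e ∈ fracEdges p, TouchesReach p ends a₃ e) →
      ∃ e ∈ fracEdges p, TouchesReach p ends a₃ e ∧ GoodEdgeSub p ends o a₁ a₂ a₃ b e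

omit [IsStrictOrderedRing R] in
/-- `CPolarA3Sub_all` is weaker than `CPolarA3ExistsRR_all`. -/
theorem cpolarA3Sub_all_of_cpolarA3ExistsRR_all (h : CPolarA3ExistsRR_all R) :
    CPolarA3Sub_all R := by
  intro V E _ _ _ _ ends p hp o a₁ a₂ a₃ b h1 h2 h3 h4 h5 h6 h7 h8 h9 h10 hfree hex
  obtain ⟨e, he, ht, hg⟩ := h V E ends p hp o a₁ a₂ a₃ b h1 h2 h3 h4 h5 h6 h7 h8 h9 h10 hfree hex
  exact ⟨e, he, ht, Or.inl hg⟩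

/-- **(SUB) at one `a₃`-edge per mark-free instance implies the crux.** -/
theorem HCov_all_of_cpolarA3Sub_all (h : CPolarA3Sub_all R) : HCov_all R := by
  intro V E _ _ _ _ ends p hp o a₁ a₂ a₃ b h1 h2 h3 h4 h5 h6 h7 h8 h9 h10
  exact HCov_of_bern_a3_exists_sub ends o a₁ a₂ a₃ b
    (fun q hq hfree hex => h V E ends q hq o a₁ a₂ a₃ b h1 h2 h3 h4 h5 h6 h7 h8 h9 h10 hfree hex)
    p hp

end Closure

end CPolarSub

end Summit.Ventures.PercRepro2
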